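import Mathlib.RingTheory.Ideal.MinimalPrime.Noetherian
import Mathlib.RingTheory.Finiteness.Ideal
import HarnessLib

/-!
# A uniform multiplier off one minimal prime (crux `FrobeniusLadder.FRationalResolution`, line `Sketch`)

Stub `exists_multiplier_off_minimalPrime` of the skeleton `Sketch` for crux
stmt-ResolutionOfSingularities-15317 (theme LOC: F-rationality localizes, Hochster–Huneke 1994,
Thm. 4.2 (f)). For an ideal `I` of a Noetherian ring `R` and a minimal prime `P` of `I` there is an
element `t ∉ P` such that every OTHER minimal prime `Q` of `I` admits `a ∉ Q` with `a * t ∈ I`.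

Proof: the minimal primes of `I` form a finite set (`Ideal.finite_minimalPrimes_of_isNoetherianRing`)
and `I.radical ^ k ≤ I` for some `k` (`Ideal.exists_radical_pow_le_of_fg`). Let `𝒬` be the finite set
of minimal primes other than `P`. By prime avoidance for finite intersections
(`Ideal.IsPrime.inf_le'`) and minimality, `⨅ 𝒬 ≰ P`: pick `t₀ ∈ ⨅ 𝒬` with `t₀ ∉ P` and put
`t := t₀ ^ k`. Given `Q ∈ 𝒬`, minimality of `Q` gives `b ∈ P` with `b ∉ Q`; then `b * t₀` lies in
every minimal prime of `I`, i.e. in `I.radical = sInf I.minimalPrimes`, so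
`(b * t₀) ^ k = b ^ k * t₀ ^ k ∈ I`, and `a := b ^ k ∉ Q`.
-/

-- single-problem summit: the doubled namespace component `ResolutionOfSingularities` is forced
set_option linter.dupNamespace false

namespace Summit.ResolutionOfSingularities.ResolutionOfSingularities.Theorems.FRationalResolution

/-- Two comparable minimal primes of the same ideal are equal: if `Q ≤ P` with `P, Q` both minimal
over `I` then `Q = P`. -/
theorem eq_of_mem_minimalPrimes_of_le {R : Type*} [CommSemiring R] {I P Q : Ideal R}
    (hP : P ∈ I.minimalPrimes) (hQ : Q ∈ I.minimalPrimes) (hQP : Q ≤ P) : Q = P :=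
  le_antisymm hQP (hP.2 ⟨hQ.1.1, hQ.1.2⟩ hQP)

/-- **A uniform multiplier off one minimal prime.** For an ideal `I` of a Noetherian ring and a minimal
prime `P` of `I`, some `t ∉ P` multiplies, for every other minimal prime `Q` of `I`, a suitable
element `a ∉ Q` into `I`. -/
theorem exists_multiplier_off_minimalPrime (R : Type) [CommRing R] [IsNoetherianRing R]
    (I P : Ideal R) (hP : P ∈ I.minimalPrimes) :
    ∃ t : R, t ∉ P ∧ ∀ Q ∈ I.minimalPrimes, Q ≠ P → ∃ a : R, a ∉ Q ∧ a * t ∈ I := by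
  classical
  have hPpr : P.IsPrime := hP.1.1
  have hfin : I.minimalPrimes.Finite := Ideal.finite_minimalPrimes_of_isNoetherianRing R I
  obtain ⟨k, hk⟩ : ∃ k : ℕ, I.radical ^ k ≤ I :=
    Ideal.exists_radical_pow_le_of_fg I (IsNoetherian.noetherian _)
  -- the other minimal primes, as a finset
  set S : Finset (Ideal R) := hfin.toFinset.erase P with hS
  have hmemS : ∀ Q : Ideal R, Q ∈ S ↔ Q ≠ P ∧ Q ∈ I.minimalPrimes := by
    intro Q
    rw [hS, Finset.mem_erase, Set.Finite.mem_toFinset]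
  -- prime avoidance for the finite intersection `⨅ S`
  have hnot : ¬ S.inf id ≤ P := by
    intro hle
    obtain ⟨Q, hQS, hQP⟩ := hPpr.inf_le'.1 hle
    obtain ⟨hQne, hQ⟩ := (hmemS Q).1 hQS
    exact hQne (eq_of_mem_minimalPrimes_of_le hP hQ hQP)
  obtain ⟨t₀, ht₀S, ht₀P⟩ := SetLike.not_le_iff_exists.1 hnot
  have ht₀ : ∀ Q ∈ S, t₀ ∈ Q := by
    simpa only [Submodule.mem_finsetInf, id] using ht₀S
  refine ⟨t₀ ^ k, fun h => ht₀P (hPpr.mem_of_pow_mem k h), ?_⟩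
  intro Q hQ hQne
  have hQpr : Q.IsPrime := hQ.1.1
  have hQS : Q ∈ S := (hmemS Q).2 ⟨hQne, hQ⟩
  -- `P ≰ Q` by minimality of `Q`
  have hPQ : ¬ P ≤ Q := fun hle => hQne (eq_of_mem_minimalPrimes_of_le hQ hP hle).symm
  obtain ⟨b, hbP, hbQ⟩ := SetLike.not_le_iff_exists.1 hPQ
  -- `b * t₀` lies in every minimal prime of `I`, hence in the radical
  have hrad : b * t₀ ∈ I.radical := by
    rw [← Ideal.sInf_minimalPrimes, Submodule.mem_sInf]
    intro Q' hQ'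
    by_cases hQ'P : Q' = P
    · subst hQ'P
      exact Ideal.mul_mem_right _ _ hbP
    · exact Ideal.mul_mem_left _ _ (ht₀ Q' ((hmemS Q').2 ⟨hQ'P, hQ'⟩))
  refine ⟨b ^ k, fun h => hbQ (hQpr.mem_of_pow_mem k h), ?_⟩
  rw [← mul_pow]
  exact hk (Ideal.pow_mem_pow hrad k)

end Summit.ResolutionOfSingularities.ResolutionOfSingularities.Theorems.FRationalResolution
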